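import Mathlib

/-!
# `OrbitDimensionBound` (stmt-ValiantsHypothesis-16133), rung line `no_minor_covering` — stub `stub_gradedNormalForm`,
# part A: linear-algebra preliminaries

Toolkit for `Theorems/FreeSubtorusOrbitDimensionBoundStubGradedNormalForm.lean` (the graded NORMAL form of a regular
affine pencil under an exact lift): coordinates in a basis of generalised eigenvectors vanish off the weight
(`repr_eq_zero_of_mem_maxGen`), a proper subspace misses some generalised eigenvector (`exists_mem_maxGen_not_mem`),
`0` is not a generalised eigenvalue of an invertible matrix (`maxGenEigenspace_zero_eq_bot`), the kernel of a corank-one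
matrix is a line (`ker_eq_span_of_rank`), replacing one column (`updateCol_mulVec_eq`), and the basis of columns of an
invertible matrix (`exists_basis_cols`).  All statements over `ℂ` and `Fin m`.

Helper mode (`--supports stmt-ValiantsHypothesis-16133 --as helper`); no definitions.  Honest framing: bookkeeping for a
dormant rung line; `OrbitDimensionBound`, `FreeSubtorus` and VP ≠ VNP are OPEN and not moved.
-/

open Matrix Module.End

-- the mandated summit-side namespace repeats a component by design (single-problem summit)
set_option linter.dupNamespace false

namespace Summit.ValiantsHypothesis.ValiantsHypothesis.Theorems.FreeSubtorusOrbitDimensionBound.GradedNormalForm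

noncomputable section

variable {m : ℕ}

/-! ### Coordinates in a basis of generalised eigenvectors -/

/-- In a basis `b` of generalised eigenvectors (`b i ∈ E_G(wt i)`), the coordinates of a vector of `E_G(μ)` vanish at every
index of weight `≠ μ` (independence of the generalised eigenspaces). [folklore] -/
theorem repr_eq_zero_of_mem_maxGen (G : Module.End ℂ (Fin m → ℂ)) (b : Module.Basis (Fin m) ℂ (Fin m → ℂ))
    (wt : Fin m → ℂ) (hb : ∀ i, b i ∈ G.maxGenEigenspace (wt i)) (x : Fin m → ℂ) (μ : ℂ)
    (hx : x ∈ G.maxGenEigenspace μ) (i : Fin m) (hi : wt i ≠ μ) : b.repr x i = 0 := by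
  classical
  -- the part of `x` carried by the indices of weight `μ`
  set f : Fin m →₀ ℂ := (b.repr x).filter (fun j => wt j = μ) with hf
  set x₁ : Fin m → ℂ := b.repr.symm f with hx₁
  have hx₁mem : x₁ ∈ G.maxGenEigenspace μ := by
    rw [hx₁, Module.Basis.repr_symm_apply, Finsupp.linearCombination_apply, Finsupp.sum]
    refine Submodule.sum_mem _ fun j hj => Submodule.smul_mem _ _ ?_
    have hwt : wt j = μ := by
      rw [Finsupp.mem_support_iff, hf, Finsupp.filter_apply] at hj
      by_contra h
      exact hj (if_neg h)
    exact hwt ▸ hb j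
  -- the rest lies in the other generalised eigenspaces
  set y : Fin m → ℂ := x - x₁ with hy
  have hyrepr : b.repr y = b.repr x - f := by
    rw [hy, map_sub, hx₁, LinearEquiv.apply_symm_apply]
  have hymem' : y ∈ ⨆ (ν : ℂ) (_ : ν ≠ μ), G.maxGenEigenspace ν := by
    have : y = b.repr.symm (b.repr x - f) := by rw [← hyrepr, LinearEquiv.symm_apply_apply]
    rw [this, Module.Basis.repr_symm_apply, Finsupp.linearCombination_apply, Finsupp.sum]
    refine Submodule.sum_mem _ fun j hj => Submodule.smul_mem _ _ ?_
    have hwt : wt j ≠ μ := by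
      intro h
      rw [Finsupp.mem_support_iff, Finsupp.sub_apply, hf, Finsupp.filter_apply, if_pos h, sub_self] at hj
      exact hj rfl
    exact Submodule.mem_iSup_of_mem (wt j) (Submodule.mem_iSup_of_mem hwt (hb j))
  have hymem : y ∈ G.maxGenEigenspace μ := Submodule.sub_mem _ hx hx₁mem
  have hy0 : y = 0 := by
    have hdis := G.independent_maxGenEigenspace μ
    exact (Submodule.disjoint_def.mp hdis) y hymem hymem'
  -- read off the coordinate
  have : b.repr x = f := by
    have h := hyrepr
    rw [hy0, map_zero] at h
    exact (sub_eq_zero.mp h.symm)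
  rw [this, hf, Finsupp.filter_apply, if_neg hi]

/-- A proper subspace of `ℂ^m` misses a generalised eigenvector of any endomorphism (`ℂ^m = ⨆_μ E_G(μ)`). [folklore] -/
theorem exists_mem_maxGen_not_mem (G : Module.End ℂ (Fin m → ℂ)) (S : Submodule ℂ (Fin m → ℂ))
    (hS : Module.finrank ℂ S < m) : ∃ (μ : ℂ) (v : Fin m → ℂ), v ∈ G.maxGenEigenspace μ ∧ v ∉ S := by
  by_contra h
  push Not at h
  have hle : (⊤ : Submodule ℂ (Fin m → ℂ)) ≤ S := by
    rw [← Module.End.iSup_maxGenEigenspace_eq_top G]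
    exact iSup_le fun μ => fun v hv => h μ v hv
  have hS' : Module.finrank ℂ S = m := by
    rw [eq_top_iff.mpr hle, finrank_top, Module.finrank_fin_fun]
  omega

/-- `0` is not a generalised eigenvalue of an invertible matrix. [folklore] -/
theorem maxGenEigenspace_zero_eq_bot (h : Matrix (Fin m) (Fin m) ℂ) (hdet : h.det ≠ 0) :
    Module.End.maxGenEigenspace (Matrix.toLin' h) 0 = ⊥ := by
  rw [Submodule.eq_bot_iff]
  intro x hx
  rw [Module.End.mem_maxGenEigenspace] at hx
  obtain ⟨k, hk⟩ := hx
  rw [zero_smul, sub_zero] at hk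
  -- `(toLin' h)^k = toLin' (h^k)` is injective
  have hinj : ∀ (j : ℕ) (y : Fin m → ℂ), ((Matrix.toLin' h) ^ j) y = 0 → y = 0 := by
    intro j
    induction j with
    | zero => intro y hy; simpa using hy
    | succ j ih =>
      intro y hy
      rw [pow_succ, Module.End.mul_apply, Matrix.toLin'_apply] at hy
      exact Matrix.eq_zero_of_mulVec_eq_zero hdet (ih _ hy)
  exact hinj k x hk

/-- A generalised eigenvalue of an invertible matrix is non-zero. [folklore] -/
theorem wt_ne_zero_of_mem_maxGen (h : Matrix (Fin m) (Fin m) ℂ) (hdet : h.det ≠ 0) {v : Fin m → ℂ} {μ : ℂ}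
    (hv : v ∈ Module.End.maxGenEigenspace (Matrix.toLin' h) μ) (hv0 : v ≠ 0) : μ ≠ 0 := by
  rintro rfl
  rw [maxGenEigenspace_zero_eq_bot h hdet, Submodule.mem_bot] at hv
  exact hv0 hv

/-! ### Corank one -/

/-- A square matrix of rank `m - 1` (`m ≥ 1`) has a kernel LINE: `ker A₀ = ℂ v₀` for some `v₀ ≠ 0`. [folklore] -/
theorem ker_eq_span_of_rank (A₀ : Matrix (Fin m) (Fin m) ℂ) (hm : 0 < m) (hrank : A₀.rank = m - 1) :
    ∃ v₀ : Fin m → ℂ, v₀ ≠ 0 ∧ A₀ *ᵥ v₀ = 0 ∧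
      ∀ w : Fin m → ℂ, A₀ *ᵥ w = 0 → ∃ t : ℂ, w = t • v₀ := by
  classical
  have hker : Module.finrank ℂ (LinearMap.ker (Matrix.toLin' A₀)) = 1 := by
    have h1 := LinearMap.finrank_range_add_finrank_ker (Matrix.toLin' A₀)
    have h2 : Module.finrank ℂ (LinearMap.range (Matrix.toLin' A₀)) = m - 1 := by
      rw [Matrix.toLin'_apply', ← hrank]; rfl
    rw [h2, Module.finrank_fin_fun] at h1
    omega
  have hne : LinearMap.ker (Matrix.toLin' A₀) ≠ ⊥ := by
    intro h; rw [h, finrank_bot] at hker; exact zero_ne_one hker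
  obtain ⟨v₀, hv₀mem, hv₀⟩ := Submodule.exists_mem_ne_zero_of_ne_bot hne
  have hspan : LinearMap.ker (Matrix.toLin' A₀) = Submodule.span ℂ {v₀} := by
    refine (Submodule.eq_of_le_of_finrank_eq ?_ ?_).symm
    · rw [Submodule.span_singleton_le_iff_mem]; exact hv₀mem
    · rw [finrank_span_singleton hv₀, hker]
  refine ⟨v₀, hv₀, by simpa [LinearMap.mem_ker, Matrix.toLin'_apply] using hv₀mem, fun w hw => ?_⟩
  have hwmem : w ∈ LinearMap.ker (Matrix.toLin' A₀) := by
    rw [LinearMap.mem_ker, Matrix.toLin'_apply]; exact hw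
  rw [hspan, Submodule.mem_span_singleton] at hwmem
  obtain ⟨t, ht⟩ := hwmem
  exact ⟨t, ht.symm⟩

/-! ### Replacing one column -/

/-- `(M with column i₀ replaced by v) c = M (c with c_{i₀} := 0) + c_{i₀} v`. [folklore] -/
theorem updateCol_mulVec_eq (M : Matrix (Fin m) (Fin m) ℂ) (i₀ : Fin m) (v c : Fin m → ℂ) :
    (M.updateCol i₀ v) *ᵥ c = M *ᵥ Function.update c i₀ 0 + c i₀ • v := by
  classical
  ext k
  simp only [Matrix.mulVec, dotProduct, Matrix.updateCol_apply, Pi.add_apply, Pi.smul_apply, smul_eq_mul,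
    Function.update_apply, mul_ite, mul_zero, ite_mul]
  rw [show (∑ j, if j = i₀ then v k * c j else M k j * c j) =
      (∑ j, if j = i₀ then (0 : ℂ) else M k j * c j) + ∑ j, (if j = i₀ then v k * c j else 0) by
    rw [← Finset.sum_add_distrib]
    refine Finset.sum_congr rfl fun j _ => ?_
    split_ifs <;> simp]
  rw [Finset.sum_ite_eq' Finset.univ i₀, if_pos (Finset.mem_univ _), mul_comm]

/-! ### The basis of columns of an invertible matrix -/

/-- The columns of an invertible matrix `R` form a basis `b` of `ℂ^m` with `b j = R.col j`; its coordinate map is `R⁻¹`, so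
`b.toMatrix std * R = 1` and `std.toMatrix b = R`. [folklore] -/
theorem exists_basis_cols (R : Matrix (Fin m) (Fin m) ℂ) (hR : R.det ≠ 0) :
    ∃ b : Module.Basis (Fin m) ℂ (Fin m → ℂ), (∀ j, b j = R.col j) ∧
      (Pi.basisFun ℂ (Fin m)).toMatrix b = R ∧ b.toMatrix (Pi.basisFun ℂ (Fin m)) * R = 1 := by
  classical
  let inst : Invertible R := Matrix.invertibleOfIsUnitDet R (isUnit_iff_ne_zero.mpr hR)
  let e := Matrix.toLinearEquiv' R inst
  let b := (Pi.basisFun ℂ (Fin m)).map e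
  have hb : ∀ j, b j = R.col j := by
    intro j
    show e (Pi.basisFun ℂ (Fin m) j) = R.col j
    rw [Pi.basisFun_apply]
    show Matrix.toLin' R (Pi.single j 1) = R.col j
    rw [Matrix.toLin'_apply, Matrix.mulVec_single_one]
  have hstd : (Pi.basisFun ℂ (Fin m)).toMatrix b = R := by
    ext i j
    rw [Module.Basis.toMatrix_apply, hb, Pi.basisFun_repr, Matrix.col_apply]
  refine ⟨b, hb, hstd, ?_⟩
  rw [← hstd]
  exact Module.Basis.toMatrix_mul_toMatrix_flip b (Pi.basisFun ℂ (Fin m))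

end

end Summit.ValiantsHypothesis.ValiantsHypothesis.Theorems.FreeSubtorusOrbitDimensionBound.GradedNormalForm
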